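import Mathlib
import Literature.Geometry.Lorentzian.IPlusRegular
import Literature.Geometry.Lorentzian.Einstein
import HarnessLib

/-!
# Chruściel–Costa 2008, Theorem 4.5: the equivariant time function of an `I⁺`-regular domain of
outer communications, up to the event horizon (named fact, D-0014; topic `Literature/Geometry/Lorentzian`)

P. T. Chruściel, J. Lopes Costa, *On uniqueness of stationary vacuum black holes*, Astérisque
**321** (2008) 195–265 = arXiv:0806.0016, §4.2, Theorem 4.5 (Structure theorem), printed: "Suppose
that `(𝓜, ⁴g)` is [an `I⁺`-regular] stationary space-time invariant under a commutative group of
isometries `ℝ × 𝕋^{s-1}`, `s ≥ 1`, with the stationary Killing vector `K₍₀₎` tangent to the orbits of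
the `ℝ` factor. There exists on `⟨⟨M_ext⟩⟩` a smooth time function `t`, invariant under `𝕋^{s-1}`,
which together with the flow of `K₍₀₎` induces the diffeomorphisms
`⟨⟨M_ext⟩⟩ ≈ ℝ × 𝒮̊₀`, `closure ⟨⟨M_ext⟩⟩ ∩ I⁺(M_ext) ≈ ℝ × 𝒮̄₀` (4.11), where `𝒮₀ := t⁻¹(0)` is
asymptotically flat, (invariant under `𝕋^{s-1}`), with the boundary `∂𝒮̄₀` being a compact
cross-section of `𝓔⁺`. The smooth hypersurface with boundary `𝒮̄₀` is acausal, spacelike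
up-to-boundary, and the flow of `K₍₀₎` is a translation along the `ℝ` factor in (4.11)."  The proof
(end of §4.2) defines `t(p)` as "the unique value of parameter `t` so that `φ_t(p) ∈ 𝒮₀`".

Recorded here in the case `s = 1` (no axial symmetry assumed — the theorem's `𝕋^{s-1}` is then
trivial) on a `StationaryAFBlackHole` (`IPlusRegular.lean` renders Def. 1.1 as `IsIPlusRegular`),
and WEAKENED to the part of the conclusion that concerns the function `t` alone, in the tree's
vocabulary: since `closure ⟨⟨M_ext⟩⟩ ∩ I⁺(M_ext) = ⟨⟨M_ext⟩⟩ ∪ 𝓔⁺` (`𝓔⁺ = ∂⟨⟨M_ext⟩⟩ ∩ I⁺(M_ext)`,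
(2.5), and `⟨⟨M_ext⟩⟩ ⊆ I⁺(M_ext)`), the second diffeomorphism of (4.11) says that `t` (the
`ℝ`-coordinate of `ℝ × 𝒮̄₀`, with the sign making the flow a translation by `+s`) is a continuous
function on `⟨⟨M_ext⟩⟩ ∪ 𝓔⁺ = 𝓑.doc ∪ 𝓑.horizon`, smooth on the open part `𝓑.doc`, and
EQUIVARIANT: `t (φ_s p) = t p + s` along every orbit of the stationary Killing field starting in
`𝓑.doc ∪ 𝓑.horizon` (both sets are flow-invariant, `StationaryAFBlackHole.exists_stationary_flow`).
The time-function property (`∇t` timelike), the asymptotic flatness of `𝒮₀` and the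
manifold-with-boundary structure of `𝒮̄₀` are deliberately NOT recorded.
-- TODO(general form): the full diffeomorphisms (4.11) with `𝒮̄₀` a smooth spacelike hypersurface
-- with compact boundary a cross-section of `𝓔⁺`, and the `𝕋^{s-1}`-invariant version.

Used by the crux `NonTrappingHawkingRigidity` of the summit `FinalStateConjecture` (line `Sketch`,
stub `stub_invariantKillingSubcollar`: a Killing field given on an arbitrary open neighbourhood of
`𝓔⁺` and commuting with `T` there is re-defined flow-invariantly by transporting its values on the
slice `{t = t₀}`; the continuity of `t` up to `𝓔⁺` is what keeps the transport inside the given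
neighbourhood near the horizon).  The tree proves the theorem in the strictly stationary case
(`T` timelike on all of `⟨⟨M_ext⟩⟩`, no horizon clause): `IsIPlusRegular.exists_docTimeFunction`,
`IsIPlusRegular.exists_docTrivialization` (`DocStationarySpacetime.lean`); the general
`I⁺`-regular case (ergoregion allowed) rests on Prop. 4.6 (Wald's averaging construction) and the
Lipschitz-hypersurface smoothing of §4.2, not in the tree.

## References
* P. T. Chruściel, J. Lopes Costa, Astérisque 321 (2008) 195–265, arXiv:0806.0016, §4.2, Thm. 4.5
  and Prop. 4.6. [ChruscielCosta2008]
* P. T. Chruściel, J. Lopes Costa, M. Heusler, Living Rev. Relativity 15 (2012) 7, §3.1, Thm. 3.2.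
-/

noncomputable section

open Bundle Set
open scoped Manifold ContDiff Topology

namespace Literature.Geometry.Lorentzian

/-- **Chruściel–Costa 2008, Thm. 4.5 (structure theorem), the time-function part, `s = 1`.**  For an
`I⁺`-regular stationary asymptotically flat black hole there is a function `t` on space-time which is
`C^∞` on the domain of outer communications `⟨⟨M_ext⟩⟩ = 𝓑.doc`, continuous on
`⟨⟨M_ext⟩⟩ ∪ 𝓔⁺ = closure ⟨⟨M_ext⟩⟩ ∩ I⁺(M_ext)` (the `ℝ`-coordinate of the diffeomorphism
`closure ⟨⟨M_ext⟩⟩ ∩ I⁺(M_ext) ≈ ℝ × 𝒮̄₀` of (4.11)), and along which the flow of the stationary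
Killing field is translation: `t (γ s) = t (γ 0) + s` for every integral curve `γ` of `T` starting
in `⟨⟨M_ext⟩⟩ ∪ 𝓔⁺` ("the flow of `K₍₀₎` is a translation along the `ℝ` factor").  Weakening of the
printed statement (time-function property, asymptotic flatness of the slice and its boundary
structure dropped). [cite: ChruscielCosta2008, Thm. 4.5] -/
def chruscielCosta2008_equivariantTimeFunction : Prop :=
  ∀ (𝓑 : StationaryAFBlackHole.{0}) [𝓑.metric.HasLeviCivita], 𝓑.IsIPlusRegular →
    ∃ t : 𝓑.carrier → ℝ,
      ContMDiffOn (𝓡 4) 𝓘(ℝ, ℝ) ((⊤ : ℕ∞) : WithTop ℕ∞) t 𝓑.doc ∧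
      ContinuousOn t (𝓑.doc ∪ 𝓑.horizon) ∧
      ∀ γ : ℝ → 𝓑.carrier, IsMIntegralCurve γ 𝓑.killing → γ 0 ∈ 𝓑.doc ∪ 𝓑.horizon →
        ∀ s : ℝ, t (γ s) = t (γ 0) + s

/-- **Chruściel–Costa 2008, Thm. 4.5 (structure theorem), the time-function part WITH spacelike level
sets, `s = 1`.**  For a vacuum, `I⁺`-regular stationary asymptotically flat black hole (vacuum supplies
the null energy condition under which `⟨⟨M_ext⟩⟩` has one asymptotically flat end, Thm. 2.3 / §6.2,
the standing hypothesis "`closure (𝒮 ∖ 𝒮_ext)` compact" of §4.2) there is a function `t` on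
space-time, `C^∞` on `⟨⟨M_ext⟩⟩ = 𝓑.doc`, along which the flow of the stationary Killing field is
translation — `t (γ s) = t (γ 0) + s` for every integral curve `γ` of `T` starting in `⟨⟨M_ext⟩⟩`
("the flow of `K₍₀₎` is a translation along the `ℝ` factor" in `⟨⟨M_ext⟩⟩ ≈ ℝ × 𝒮̊₀`, (4.11)) — and
whose level sets in `⟨⟨M_ext⟩⟩`, the flow-translates of the smooth spacelike hypersurface
`𝒮₀ = t⁻¹(0)` ("the smooth hypersurface with boundary `𝒮̄₀` is acausal, spacelike up-to-boundary";
end of the proof: "since the level sets of `t` are smooth spacelike hypersurfaces, `t` is a smooth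
time function"), contain no non-zero causal vector: `dt_x(k) ≠ 0` for every `x ∈ ⟨⟨M_ext⟩⟩` and every
causal `k ≠ 0` (differentiating the equivariance gives `dt(T) = 1`, so `dt_x ≠ 0` and `ker dt_x` is
the tangent space of the level set through `x`, a spacelike hyperplane).  Weakening of the printed
statement (the diffeomorphisms (4.11), asymptotic flatness of `𝒮₀`, its boundary cross-section of
`𝓔⁺` and continuity up to `𝓔⁺` are dropped); companion of `chruscielCosta2008_equivariantTimeFunction`
above, which records continuity up to `𝓔⁺` instead of the spacelike clause (the spacelike clause is
what makes `t` a yardstick for null geodesics: the Killing-time frequency `dt(γ̇)` of a null geodesic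
never vanishes).
-- TODO(general form): the `𝕋^{s-1}`-invariant version and the full product structure (4.11) with
-- spacelike slices (cf. `chruscielCosta2008_docProductStructure`, which also drops the spacelike clause).
[cite: ChruscielCosta2008, Thm. 4.5] -/
def chruscielCosta2008_spacelikeTimeFunction : Prop :=
  ∀ (𝓑 : StationaryAFBlackHole.{0}) [𝓑.metric.HasLeviCivita],
    𝓑.metric.toPseudoRiemannianMetric.IsRicciFlat → 𝓑.IsIPlusRegular →
    ∃ t : 𝓑.carrier → ℝ,
      ContMDiffOn (𝓡 4) 𝓘(ℝ, ℝ) ((⊤ : ℕ∞) : WithTop ℕ∞) t 𝓑.doc ∧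
      (∀ γ : ℝ → 𝓑.carrier, IsMIntegralCurve γ 𝓑.killing → γ 0 ∈ 𝓑.doc →
        ∀ s : ℝ, t (γ s) = t (γ 0) + s) ∧
      ∀ x ∈ 𝓑.doc, ∀ k : TangentSpace (𝓡 4) x, 𝓑.metric.val x k k ≤ 0 → k ≠ 0 →
        mvfderiv (𝓡 4) t x k ≠ 0

end Literature.Geometry.Lorentzian

end
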